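/-
Copyright (c) 2026 the pub-hodgecm-mathlib formalisation cell (harness21).  Prover seat hodgecm-mathlib-LH4-p09 (g8), req620 Track A «(D-RAM) FOUR-FRAME» squad
(heir LEAD F0P3a-plan (g20) T19-24 «STAGE-1b PRE-SCOPING BY IDLE HANDS: ALLOWED AS SCOPING»; dealer LH4-plan (g12) WORD #49 «(L-model-G)»; heir dealer LH4-plan (g13)).  2026-09-04.
-/
import Summits.HodgeConjecture.HodgeConjecture.Theorems.F0P3cDyRamLabelledCoreHangingLocusCensus   -- (this seat): H on-locus census in `R`-currency; brings ★ B7 (B)∕(D1), ★ bridge `exists_fixed_near_glueUnit_iff_le`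
import HarnessLib

/-!
# (D-RAM) four-frame, STAGE 1b scoping — unit (L-model-G) item (3) ON THE LOCUS, HEADS: the labelled core-hanging stratum `H (2ρ, 2ρ, 2ρ)` — tube and
# foot censuses in CLOSED FORM, and the model token `D₁ = diag(α−1, β−1, 0)` on `H` made fully numeric

STAGE-1b SCOPING BRICK in the sense of heir LEAD F0P3a-plan (g20) T19-24 and dealer LH4-plan (g12) WORD #49 (unit «(L-model-G)», items (1)+(3)): `Theorems/` only,
statement-first, ★-only imports, helper lane `--supports stmt-HodgeConjecture-24833 --as helper`; it PAYS NO tier-0 row and states no STAGE-1b law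
(count-neutral; rule 66: a census, not a law).

THE CENSUS (`v(e₂−e₀) = v(e₂−e₁) = k`, `E = ℓ + 2ρ − k`, `g_e = (e₂−e₁)∕(e₂−e₀)` a unit, `g₀ = (β−1)∕(α−1)`).  TUBE (`2ρ ≤ n₁, n₂`, `ρ ≤ n₃`):
`Σᶠ_{M ∈ H, diag(e)M ⊆ ϖ^ℓM} w = [outer] · ( (q−2)q^{2ρ−1} if ℓ+2ρ ≤ k (vacuous: ★ B7's tube value) ; q^{2ρ−⌈E∕2⌉}·[|e₁−e₀| = |ϖ|^k ∧ ∃ f₀ = σf₀ : |f₀+g_e| ≤ |ϖ|^E] otherwise )`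
— the new twist at `s = 0` is ADMISSIBILITY: `1 + g = (1 − g_e) + (g + g_e)` and `1 − g_e = (e₁−e₀)∕(e₂−e₀)`, so the token ball consists of admissible classes iff
`|e₁ − e₀| = |ϖ|^k` and of inadmissible ones otherwise (§1).  FOOT (`n₁ = n₂ = n₃ = m`, `ρ ≤ m < 2ρ`, `e₀ = 2ρ − m`):
`= [outer] · ( q^{2ρ−⌈e₀∕2⌉}·[∃ f₀ : |f₀+g₀| ≤ |ϖ|^{e₀}] if ℓ+2ρ ≤ k ; q^{2ρ−⌈max(e₀,E)∕2⌉}·[∃ f₀ = σf₀ : |f₀+g₀| ≤ |ϖ|^{e₀} ∧ |f₀+g_e| ≤ |ϖ|^E] otherwise )`.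
MODEL TOKEN `D₁`: `k = n₂`, locus `n₁ = n₂`, `g_e = g₀`, `|e₁−e₀| = |ϖ|^{n₃}`; the ★ bridge `exists_fixed_near_glueUnit_iff_le` makes both regimes numeric (§3).

* §1 `one_sub_glueRatio_eq`, `v_one_add_eq_one_of_ball`, `v_one_add_lt_one_of_ball`, `v_glueUnit_eq_one`.
* §2 **`finsum_stabiliserWeight_stratum_H_sep_onLocus_tube`**, **`finsum_stabiliserWeight_stratum_H_sep_onLocus_foot`** (closed forms).
* §3 **`finsum_stabiliserWeight_stratum_H_sep_modelToken_tube`**, **`finsum_stabiliserWeight_stratum_H_sep_modelToken_foot`** (numeric).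

HONEST LABEL: scoping inventory; STAGE-1b tier-0 rows T₊∕T₋∕regular stay OPEN; HC_CM is proved only modulo the 7 printed citations (2 remaining named
inputs: hLiu418 = `stmt-HodgeConjecture-24832`, h413 = `stmt-HodgeConjecture-24833`) until rung 0 closes.

## References
* [Kottwitz1986BaseChangeUnits] R. E. Kottwitz, *Base change for unit elements of Hecke algebras*, Compositio Math. 60 (1986), §1 pp. 240–241 (lattice counts via torus orbits and stabilisers).
* [Rogawski1990] J. D. Rogawski, *Automorphic Representations of Unitary Groups in Three Variables*, Ann. of Math. Stud. 123 (1990), §4.9 Prop. 4.9.1 (a) p. 55.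
* [Serre1979] J.-P. Serre, *Local Fields*, GTM 67 (1979), Ch. IV §2 Prop. 6 (unit filtration counts behind ★ (B)∕(D1) and the ★ bridge).
* [Serre1980Trees] J.-P. Serre, *Trees*, Springer (1980), Ch. II §1.1 (the ultrametric inequality).
-/

set_option autoImplicit false

noncomputable section

namespace Summit.HodgeConjecture.HodgeConjecture.Cruxes.H413.F0P3cDyRamLabelledCoreHangingLocusCensusClosed

open Matrix WithZero
open Literature.NumberTheory.Automorphic Literature.NumberTheory.Automorphic.HermitianLattice
open Literature.NumberTheory.Automorphic.UnitaryLatticeTree Literature.NumberTheory.Automorphic.UnitaryThreeFourFrame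
open Literature.NumberTheory.LocalFields.WildQuadraticDatum
open Summit.HodgeConjecture.HodgeConjecture.Cruxes.H413.F0P3cDyRamDiagonalTorusDefs
open Summit.HodgeConjecture.HodgeConjecture.Cruxes.H413.F0P3cDyRamDiagonalStrataDefs
open Summit.HodgeConjecture.HodgeConjecture.Cruxes.H413.F0P3cDyRamDiagonalGluedStabiliserIndex (ne_zero_and_v_lt_one_of_v_eq_exp)
open Summit.HodgeConjecture.HodgeConjecture.Cruxes.H413.F0P3cDyRamDiagonalGluedClassRepresentatives (exists_fixed_class_representatives)
open Summit.HodgeConjecture.HodgeConjecture.Cruxes.H413.F0P3cDyRamDiagonalCoreHangingClasses (ncard_admissible_representatives_eq)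
open Summit.HodgeConjecture.HodgeConjecture.Cruxes.H413.F0P3cDyRamDiagonalCoreHangingFoot (ncard_glue_representatives_eq glue_representatives_eq_empty)
open Summit.HodgeConjecture.HodgeConjecture.Cruxes.H413.F0P3cDyRamElementDatumParity (isoceles_of_isElementDatum)
open Summit.HodgeConjecture.HodgeConjecture.Cruxes.H413.F0P3cDyRamGlueUnitRationalityDepth (exists_fixed_near_glueUnit_iff_le)
open Summit.HodgeConjecture.HodgeConjecture.Cruxes.H413.F0P3cDyRamFourFrameCensusDefs
open Summit.HodgeConjecture.HodgeConjecture.Cruxes.H413.F0P3cDyRamDiagonalGluedStabiliserMembership (pow_mul_le_pow_add_iff)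
open Summit.HodgeConjecture.HodgeConjecture.Cruxes.H413.F0P3cDyRamLabelledGluedLocusCensusFoot (ball_of_witness glueRatio_modelToken_eq)
open Summit.HodgeConjecture.HodgeConjecture.Cruxes.H413.F0P3cDyRamLabelledCoreHangingLocusCensus
open scoped Valued WithZero Matrix MatrixGroups

/-! ## §1  Admissibility on the token ball -/

section Tools

variable {K : Type*} [Field K] [Valued K ℤᵐ⁰]

omit [Valued K ℤᵐ⁰] in
/-- `1 − g_e = (e₁ − e₀)∕(e₂ − e₀)` (`e₂ ≠ e₀`). [cite: Kottwitz1986BaseChangeUnits, §1 pp. 240–241] -/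
theorem one_sub_glueRatio_eq {e : Fin 3 → K} (he : e 2 - e 0 ≠ 0) : 1 - (e 2 - e 1) / (e 2 - e 0) = (e 1 - e 0) / (e 2 - e 0) := by
  field_simp
  ring

/-- **THE TOKEN BALL IS ADMISSIBLE** when `|e₁ − e₀| = |ϖ|^k = |e₂ − e₀|`: `|g + g_e| ≤ |ϖ|^E` with `E ≥ 1` forces `|1 + g| = 1` (`1 + g = (1 − g_e) + (g + g_e)`,
`|1 − g_e| = 1`). [cite: Serre1980Trees, II §1.1] -/
theorem v_one_add_eq_one_of_ball {ϖ : K} (hϖ0 : ϖ ≠ 0) (hϖ1 : Valued.v ϖ < 1) {k E : ℕ} (hE : 1 ≤ E) {e : Fin 3 → K}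
    (hk : Valued.v (e 2 - e 0) = Valued.v ϖ ^ k) (h10 : Valued.v (e 1 - e 0) = Valued.v ϖ ^ k) {g : K}
    (hg : Valued.v (g + (e 2 - e 1) / (e 2 - e 0)) ≤ Valued.v ϖ ^ E) : Valued.v (1 + g) = 1 := by
  have hvϖ0 : Valued.v ϖ ≠ 0 := (Valuation.ne_zero_iff _).2 hϖ0
  have he : e 2 - e 0 ≠ 0 := fun h => by rw [h, map_zero] at hk; exact pow_ne_zero k hvϖ0 hk.symm
  have h1 : Valued.v (1 - (e 2 - e 1) / (e 2 - e 0)) = 1 := by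
    rw [one_sub_glueRatio_eq he, map_div₀, h10, hk, div_self (pow_ne_zero k hvϖ0)]
  have hlt : Valued.v (g + (e 2 - e 1) / (e 2 - e 0)) < Valued.v (1 - (e 2 - e 1) / (e 2 - e 0)) := by
    rw [h1]; exact hg.trans_lt (pow_lt_one₀ zero_le hϖ1 (by omega))
  rw [show (1 : K) + g = (1 - (e 2 - e 1) / (e 2 - e 0)) + (g + (e 2 - e 1) / (e 2 - e 0)) by ring, Valuation.map_add_eq_of_lt_left _ hlt, h1]

/-- **THE TOKEN BALL IS INADMISSIBLE** when `|e₁ − e₀| ≠ |ϖ|^k` (then `< |ϖ|^k`): `|g + g_e| ≤ |ϖ|^E` with `E ≥ 1` forces `|1 + g| < 1`. [cite: Serre1980Trees, II §1.1] -/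
theorem v_one_add_lt_one_of_ball {ϖ : K} (hϖ0 : ϖ ≠ 0) (hϖ1 : Valued.v ϖ < 1) {k E : ℕ} (hE : 1 ≤ E) {e : Fin 3 → K}
    (hk : Valued.v (e 2 - e 0) = Valued.v ϖ ^ k) (hloc : Valued.v (e 2 - e 1) = Valued.v ϖ ^ k) (h10 : Valued.v (e 1 - e 0) ≠ Valued.v ϖ ^ k) {g : K}
    (hg : Valued.v (g + (e 2 - e 1) / (e 2 - e 0)) ≤ Valued.v ϖ ^ E) : Valued.v (1 + g) < 1 := by
  have hvϖ0 : Valued.v ϖ ≠ 0 := (Valuation.ne_zero_iff _).2 hϖ0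
  have he : e 2 - e 0 ≠ 0 := fun h => by rw [h, map_zero] at hk; exact pow_ne_zero k hvϖ0 hk.symm
  have hle : Valued.v (e 1 - e 0) ≤ Valued.v ϖ ^ k := by
    rw [show e 1 - e 0 = (e 2 - e 0) - (e 2 - e 1) by ring]
    exact Valuation.map_sub_le _ hk.le hloc.le
  have h1 : Valued.v (1 - (e 2 - e 1) / (e 2 - e 0)) < 1 := by
    rw [one_sub_glueRatio_eq he, map_div₀, hk, div_lt_one₀ (pow_pos ((Valuation.pos_iff _).2 ((Valuation.ne_zero_iff _).1 hvϖ0)) k)]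
    exact lt_of_le_of_ne hle h10
  rw [show (1 : K) + g = (1 - (e 2 - e 1) / (e 2 - e 0)) + (g + (e 2 - e 1) / (e 2 - e 0)) by ring]
  exact (Valuation.map_add _ _ _).trans_lt (max_lt h1 (hg.trans_lt (pow_lt_one₀ zero_le hϖ1 (by omega))))

/-- `|g₀| = |(β−1)∕(α−1)| = 1` on the equal-depth locus `|β−1| = |α−1| = |ϖ|^m`. [cite: Serre1980Trees, II §1.1] -/
theorem v_glueUnit_eq_one {ϖ : K} (hvϖ0 : Valued.v ϖ ≠ 0) {α β : K} {m : ℕ} (h₁ : Valued.v (β - 1) = Valued.v ϖ ^ m)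
    (h₂ : Valued.v (α - 1) = Valued.v ϖ ^ m) : Valued.v ((β - 1) / (α - 1)) = 1 := by
  rw [map_div₀, h₁, h₂, div_self (pow_ne_zero m hvϖ0)]

end Tools

/-! ## §2  The tube and foot censuses of the labelled H weight in closed form -/

section Closed

variable {K : Type} [Field K] [Valued K ℤᵐ⁰] [Fintype 𝓀[K]] {σ : K →+* K} {ϖ : K} {d t : ℕ} {α β : K} {N₀ n₁ n₂ n₃ : ℕ} {T : GL (Fin 3) K}

open Classical in
/-- **HEAD — THE LABELLED H WEIGHT ON THE LOCUS, TUBE REGIME, CLOSED FORM** (`2ρ ≤ n₁, n₂`, `ρ ≤ n₃`; `v(e₂−e₀) = v(e₂−e₁) = k`; `E = ℓ + 2ρ − k`):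
`Σᶠ_{M ∈ H, diag(e)M ⊆ ϖ^ℓM} 1∕[𝒰 : S_F(M)] = [outer] · ( (q−2)q^{2ρ−1} if ℓ+2ρ ≤ k ; q^{2ρ−⌈E∕2⌉}·[|e₁−e₀| = |ϖ|^k ∧ ∃ f₀ = σf₀ : |f₀+g_e| ≤ |ϖ|^E] otherwise )`
— vacuous regime: ★ (B) `ncard_admissible_representatives_eq`; genuine regime: the token ball is all-admissible or all-inadmissible (§1) and is counted by ★ (D1)
`ncard_glue_representatives_eq`. [cite: Kottwitz1986BaseChangeUnits, §1 pp. 240–241] [cite: Serre1979, Ch. IV §2 Prop. 6] [cite: Rogawski1990, §4.9 Prop. 4.9.1 (a) p. 55] -/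
theorem finsum_stabiliserWeight_stratum_H_sep_onLocus_tube (hD : IsRamifiedQuadraticDatum σ ϖ d t) (h2 : Valued.v (2 : K) < 1)
    (hE : IsElementDatum σ ϖ N₀ α β n₁ n₂ n₃) (hT : (T : Matrix (Fin 3) (Fin 3) K) = Matrix.diagonal ![α, β, 1])
    (ρ : ℕ) (hρ : 1 ≤ ρ) (htube : 2 * ρ ≤ n₁ ∧ 2 * ρ ≤ n₂) (hn₃ : ρ ≤ n₃) (ℓ k : ℕ) (e : Fin 3 → K)
    (hk : Valued.v (e 2 - e 0) = Valued.v ϖ ^ k) (hloc : Valued.v (e 2 - e 1) = Valued.v ϖ ^ k) :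
    ∑ᶠ M ∈ {M | M ∈ stratum σ ϖ T ![2 * ρ, 2 * ρ, 2 * ρ] ∧ LatticeInLevel ϖ ℓ (Matrix.diagonal e) M}, stabiliserWeight σ M =
      if ((Valued.v (e 0) ≤ Valued.v ϖ ^ ℓ ∧ Valued.v (e 1) ≤ Valued.v ϖ ^ ℓ ∧ Valued.v (e 2) ≤ Valued.v ϖ ^ ℓ) ∧
          Valued.v (e 1 - e 0) ≤ Valued.v ϖ ^ (ℓ + ρ)) ∧ ℓ + ρ ≤ k then
        (if ℓ + 2 * ρ ≤ k then ((Fintype.card 𝓀[K] : ℚ) - 2) * (Fintype.card 𝓀[K] : ℚ) ^ (2 * ρ - 1)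
          else if Valued.v (e 1 - e 0) = Valued.v ϖ ^ k ∧ ∃ f : K, σ f = f ∧ Valued.v (f + (e 2 - e 1) / (e 2 - e 0)) ≤ Valued.v ϖ ^ (ℓ + 2 * ρ - k)
            then (Fintype.card 𝓀[K] : ℚ) ^ (2 * ρ - (ℓ + 2 * ρ - k + 1) / 2) else 0)
      else 0 := by
  classical
  have hσ : ∀ x, σ (σ x) = x := hD.1
  have hvσ : ∀ a, Valued.v (σ a) = Valued.v a := hD.2.1
  have hϖ : Valued.v ϖ = exp (-1 : ℤ) := hD.2.2.1
  have hfix : ∀ x : K, σ x = x → x ≠ 0 → ∃ n : ℤ, Valued.v x = exp (2 * n) := hD.2.2.2.1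
  have hd : Valued.v (ϖ - σ ϖ) = Valued.v ϖ ^ d := hD.2.2.2.2.1
  obtain ⟨hϖ0, hϖ1⟩ := ne_zero_and_v_lt_one_of_v_eq_exp hϖ
  have hvϖ0 : Valued.v ϖ ≠ 0 := (Valuation.ne_zero_iff _).2 hϖ0
  have hge : Valued.v ((e 2 - e 1) / (e 2 - e 0)) = 1 := by rw [map_div₀, hk, hloc, div_self (pow_ne_zero k hvϖ0)]
  obtain ⟨R, hRfin, hRcard, hR1, hR2, hR3⟩ := exists_fixed_class_representatives hσ hvσ hfix hϖ hd ρ 0 hρ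
  simp only [Nat.mul_zero, pow_zero, Nat.add_zero] at hR1 hR2 hR3
  rw [finsum_stabiliserWeight_stratum_H_sep_onLocus_tube_eq_ncard_mul hD h2 hE hT ρ hρ htube hn₃ ℓ k e hk hloc hRfin hR1 hR2 hR3]
  by_cases hout : ((Valued.v (e 0) ≤ Valued.v ϖ ^ ℓ ∧ Valued.v (e 1) ≤ Valued.v ϖ ^ ℓ ∧ Valued.v (e 2) ≤ Valued.v ϖ ^ ℓ) ∧
      Valued.v (e 1 - e 0) ≤ Valued.v ϖ ^ (ℓ + ρ)) ∧ ℓ + ρ ≤ k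
  · rw [if_pos hout, if_pos hout, ← Nat.card_eq_fintype_card]
    have hq : 1 < Nat.card 𝓀[K] := Finite.one_lt_card
    by_cases hvac : ℓ + 2 * ρ ≤ k
    · -- vacuous regime: the index set is the admissible representatives, ★ (B)
      have hall : {g ∈ R | Valued.v (1 + g) = 1 ∧ Valued.v ϖ ^ k * Valued.v (g + (e 2 - e 1) / (e 2 - e 0)) ≤ Valued.v ϖ ^ (ℓ + 2 * ρ)} =
          {g ∈ R | Valued.v (1 + g) = 1} :=
        Set.ext fun g => ⟨fun h => ⟨h.1, h.2.1⟩, fun h => ⟨h.1, h.2, tokenBall_unit_of_le hϖ1.le hvac (hR1 g h.1).2 hge⟩⟩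
      rw [if_pos hvac, hall, ncard_admissible_representatives_eq hσ hvσ hfix hϖ hd hρ hRfin hRcard hR1 hR2 hR3,
        show 2 * ρ - 1 = (ρ + 1) / 2 - 1 + (ρ + ρ / 2) by omega, pow_add]
      push_cast [Nat.cast_sub (show 2 ≤ Nat.card 𝓀[K] by omega)]
      ring
    · -- genuine regime `1 ≤ E ≤ ρ`
      rw [if_neg hvac]
      have hEeq : ℓ + 2 * ρ = k + (ℓ + 2 * ρ - k) := by omega
      have hball : {g ∈ R | Valued.v (1 + g) = 1 ∧ Valued.v ϖ ^ k * Valued.v (g + (e 2 - e 1) / (e 2 - e 0)) ≤ Valued.v ϖ ^ (ℓ + 2 * ρ)} =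
          {g ∈ R | Valued.v (1 + g) = 1 ∧ Valued.v (g + (e 2 - e 1) / (e 2 - e 0)) ≤ Valued.v ϖ ^ (ℓ + 2 * ρ - k)} :=
        Set.ext fun g => and_congr_right fun _ => and_congr_right fun _ => by
          rw [hEeq, pow_mul_le_pow_add_iff hϖ0, Nat.add_sub_cancel_left]
      rw [hball]
      by_cases h10 : Valued.v (e 1 - e 0) = Valued.v ϖ ^ k
      · -- all-admissible ball: ★ (D1)
        have hadm : {g ∈ R | Valued.v (1 + g) = 1 ∧ Valued.v (g + (e 2 - e 1) / (e 2 - e 0)) ≤ Valued.v ϖ ^ (ℓ + 2 * ρ - k)} =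
            {g ∈ R | Valued.v (g + (e 2 - e 1) / (e 2 - e 0)) ≤ Valued.v ϖ ^ (ℓ + 2 * ρ - k)} :=
          Set.ext fun g => ⟨fun h => ⟨h.1, h.2.2⟩, fun h => ⟨h.1, v_one_add_eq_one_of_ball hϖ0 hϖ1 (by omega) hk h10 h.2, h.2⟩⟩
        rw [hadm]
        by_cases hrat : ∃ f : K, σ f = f ∧ Valued.v (f + (e 2 - e 1) / (e 2 - e 0)) ≤ Valued.v ϖ ^ (ℓ + 2 * ρ - k)
        · rw [if_pos ⟨h10, hrat⟩]
          obtain ⟨f₀, hσf₀, hf₀⟩ := hrat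
          rw [ncard_glue_representatives_eq hσ hvσ hfix hϖ hd (by omega) (by omega) hRfin hR1 hR2 hR3 hge hσf₀ hf₀,
            show 2 * ρ - (ℓ + 2 * ρ - k + 1) / 2 = (ρ + 1) / 2 - (ℓ + 2 * ρ - k + 1) / 2 + (ρ + ρ / 2) by omega, pow_add]
          push_cast
          ring
        · rw [if_neg (fun h => hrat h.2), glue_representatives_eq_empty hR1 hrat, Set.ncard_empty, Nat.cast_zero, zero_mul]
      · -- all-inadmissible ball: empty index set
        have hemp : {g ∈ R | Valued.v (1 + g) = 1 ∧ Valued.v (g + (e 2 - e 1) / (e 2 - e 0)) ≤ Valued.v ϖ ^ (ℓ + 2 * ρ - k)} = ∅ :=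
          Set.eq_empty_of_forall_notMem fun g ⟨_, h1g, hg⟩ => (v_one_add_lt_one_of_ball hϖ0 hϖ1 (by omega) hk hloc h10 hg).ne h1g
        rw [if_neg (fun h => h10 h.1), hemp, Set.ncard_empty, Nat.cast_zero, zero_mul]
  · rw [if_neg hout, if_neg hout]

open Classical in
/-- **HEAD — THE LABELLED H WEIGHT ON THE LOCUS, FOOT REGIME, CLOSED FORM** (equilateral foot `n₁ = n₂ = n₃ = m`, `ρ ≤ m < 2ρ`; `v(e₂−e₀) = v(e₂−e₁) = k`;
`e₀ = 2ρ − m`, `E = ℓ + 2ρ − k`): `Σᶠ_{M ∈ H, diag(e)M ⊆ ϖ^ℓM} 1∕[𝒰 : S_F(M)] =`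
`[outer] · ( q^{2ρ−⌈e₀∕2⌉}·[∃ f₀ = σf₀ : |f₀+g₀| ≤ |ϖ|^{e₀}] if ℓ+2ρ ≤ k (vacuous: ★ B7's foot value) ; q^{2ρ−⌈max(e₀,E)∕2⌉}·[∃ f₀ = σf₀ in BOTH balls] otherwise )`.
[cite: Kottwitz1986BaseChangeUnits, §1 pp. 240–241] [cite: Serre1979, Ch. IV §2 Prop. 6] [cite: Rogawski1990, §4.9 Prop. 4.9.1 (a) p. 55] -/
theorem finsum_stabiliserWeight_stratum_H_sep_onLocus_foot (hD : IsRamifiedQuadraticDatum σ ϖ d t) (h2 : Valued.v (2 : K) < 1)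
    (hE : IsElementDatum σ ϖ N₀ α β n₁ n₂ n₃) (hT : (T : Matrix (Fin 3) (Fin 3) K) = Matrix.diagonal ![α, β, 1])
    (ρ : ℕ) (hρ : 1 ≤ ρ) (h12 : n₁ = n₂) (h13 : n₁ = n₃) (hρm : ρ ≤ n₁) (hm : n₁ < 2 * ρ) (ℓ k : ℕ) (e : Fin 3 → K)
    (hk : Valued.v (e 2 - e 0) = Valued.v ϖ ^ k) (hloc : Valued.v (e 2 - e 1) = Valued.v ϖ ^ k) :
    ∑ᶠ M ∈ {M | M ∈ stratum σ ϖ T ![2 * ρ, 2 * ρ, 2 * ρ] ∧ LatticeInLevel ϖ ℓ (Matrix.diagonal e) M}, stabiliserWeight σ M =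
      if ((Valued.v (e 0) ≤ Valued.v ϖ ^ ℓ ∧ Valued.v (e 1) ≤ Valued.v ϖ ^ ℓ ∧ Valued.v (e 2) ≤ Valued.v ϖ ^ ℓ) ∧
          Valued.v (e 1 - e 0) ≤ Valued.v ϖ ^ (ℓ + ρ)) ∧ ℓ + ρ ≤ k then
        (if ℓ + 2 * ρ ≤ k then
            (if ∃ f : K, σ f = f ∧ Valued.v (f + (β - 1) / (α - 1)) ≤ Valued.v ϖ ^ (2 * ρ - n₁)
              then (Fintype.card 𝓀[K] : ℚ) ^ (2 * ρ - (2 * ρ - n₁ + 1) / 2) else 0)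
          else
            (if ∃ f : K, σ f = f ∧ Valued.v (f + (β - 1) / (α - 1)) ≤ Valued.v ϖ ^ (2 * ρ - n₁) ∧
                Valued.v (f + (e 2 - e 1) / (e 2 - e 0)) ≤ Valued.v ϖ ^ (ℓ + 2 * ρ - k)
              then (Fintype.card 𝓀[K] : ℚ) ^ (2 * ρ - (max (2 * ρ - n₁) (ℓ + 2 * ρ - k) + 1) / 2) else 0))
      else 0 := by
  classical
  have hσ : ∀ x, σ (σ x) = x := hD.1
  have hvσ : ∀ a, Valued.v (σ a) = Valued.v a := hD.2.1
  have hϖ : Valued.v ϖ = exp (-1 : ℤ) := hD.2.2.1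
  have hfix : ∀ x : K, σ x = x → x ≠ 0 → ∃ n : ℤ, Valued.v x = exp (2 * n) := hD.2.2.2.1
  have hd : Valued.v (ϖ - σ ϖ) = Valued.v ϖ ^ d := hD.2.2.2.2.1
  have h₁ : Valued.v (β - 1) = Valued.v ϖ ^ n₁ := hE.2.2.2.2.2.1
  have h₂ : Valued.v (α - 1) = Valued.v ϖ ^ n₁ := by rw [h12]; exact hE.2.2.2.2.2.2.1
  obtain ⟨hϖ0, hϖ1⟩ := ne_zero_and_v_lt_one_of_v_eq_exp hϖ
  have hvϖ0 : Valued.v ϖ ≠ 0 := (Valuation.ne_zero_iff _).2 hϖ0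
  have hg₀ : Valued.v ((β - 1) / (α - 1)) = 1 := v_glueUnit_eq_one hvϖ0 h₁ h₂
  have hge : Valued.v ((e 2 - e 1) / (e 2 - e 0)) = 1 := by rw [map_div₀, hk, hloc, div_self (pow_ne_zero k hvϖ0)]
  obtain ⟨R, hRfin, -, hR1, hR2, hR3⟩ := exists_fixed_class_representatives hσ hvσ hfix hϖ hd ρ 0 hρ
  simp only [Nat.mul_zero, pow_zero, Nat.add_zero] at hR1 hR2 hR3
  rw [finsum_stabiliserWeight_stratum_H_sep_onLocus_foot_eq_ncard_mul hD h2 hE hT ρ hρ h12 h13 hρm hm ℓ k e hk hloc hRfin hR1 hR2 hR3]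
  by_cases hout : ((Valued.v (e 0) ≤ Valued.v ϖ ^ ℓ ∧ Valued.v (e 1) ≤ Valued.v ϖ ^ ℓ ∧ Valued.v (e 2) ≤ Valued.v ϖ ^ ℓ) ∧
      Valued.v (e 1 - e 0) ≤ Valued.v ϖ ^ (ℓ + ρ)) ∧ ℓ + ρ ≤ k
  · rw [if_pos hout, if_pos hout, ← Nat.card_eq_fintype_card]
    by_cases hvac : ℓ + 2 * ρ ≤ k
    · have hall : {g ∈ R | Valued.v (g + (β - 1) / (α - 1)) ≤ Valued.v ϖ ^ (2 * ρ - n₁) ∧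
            Valued.v ϖ ^ k * Valued.v (g + (e 2 - e 1) / (e 2 - e 0)) ≤ Valued.v ϖ ^ (ℓ + 2 * ρ)} =
          {g ∈ R | Valued.v (g + (β - 1) / (α - 1)) ≤ Valued.v ϖ ^ (2 * ρ - n₁)} :=
        Set.ext fun g => ⟨fun h => ⟨h.1, h.2.1⟩, fun h => ⟨h.1, h.2, tokenBall_unit_of_le hϖ1.le hvac (hR1 g h.1).2 hge⟩⟩
      rw [if_pos hvac, hall]
      by_cases hrat : ∃ f : K, σ f = f ∧ Valued.v (f + (β - 1) / (α - 1)) ≤ Valued.v ϖ ^ (2 * ρ - n₁)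
      · rw [if_pos hrat]
        obtain ⟨f₀, hσf₀, hf₀⟩ := hrat
        rw [ncard_glue_representatives_eq hσ hvσ hfix hϖ hd (by omega) (by omega) hRfin hR1 hR2 hR3 hg₀ hσf₀ hf₀,
          show 2 * ρ - (2 * ρ - n₁ + 1) / 2 = (ρ + 1) / 2 - (2 * ρ - n₁ + 1) / 2 + (ρ + ρ / 2) by omega, pow_add]
        push_cast
        ring
      · rw [if_neg hrat, glue_representatives_eq_empty hR1 hrat, Set.ncard_empty, Nat.cast_zero, zero_mul]
    · rw [if_neg hvac]
      have hEeq : ℓ + 2 * ρ = k + (ℓ + 2 * ρ - k) := by omega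
      have hball : {g ∈ R | Valued.v (g + (β - 1) / (α - 1)) ≤ Valued.v ϖ ^ (2 * ρ - n₁) ∧
            Valued.v ϖ ^ k * Valued.v (g + (e 2 - e 1) / (e 2 - e 0)) ≤ Valued.v ϖ ^ (ℓ + 2 * ρ)} =
          {g ∈ R | Valued.v (g + (β - 1) / (α - 1)) ≤ Valued.v ϖ ^ (2 * ρ - n₁) ∧
            Valued.v (g + (e 2 - e 1) / (e 2 - e 0)) ≤ Valued.v ϖ ^ (ℓ + 2 * ρ - k)} :=
        Set.ext fun g => and_congr_right fun _ => and_congr_right fun _ => by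
          rw [hEeq, pow_mul_le_pow_add_iff hϖ0, Nat.add_sub_cancel_left]
      rw [hball]
      by_cases hrat : ∃ f : K, σ f = f ∧ Valued.v (f + (β - 1) / (α - 1)) ≤ Valued.v ϖ ^ (2 * ρ - n₁) ∧
          Valued.v (f + (e 2 - e 1) / (e 2 - e 0)) ≤ Valued.v ϖ ^ (ℓ + 2 * ρ - k)
      · rw [if_pos hrat]
        obtain ⟨f₀, hσf₀, hf₀, hf₀'⟩ := hrat
        by_cases hle : 2 * ρ - n₁ ≤ ℓ + 2 * ρ - k
        · have hnest : {g ∈ R | Valued.v (g + (β - 1) / (α - 1)) ≤ Valued.v ϖ ^ (2 * ρ - n₁) ∧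
                Valued.v (g + (e 2 - e 1) / (e 2 - e 0)) ≤ Valued.v ϖ ^ (ℓ + 2 * ρ - k)} =
              {g ∈ R | Valued.v (g + (e 2 - e 1) / (e 2 - e 0)) ≤ Valued.v ϖ ^ (ℓ + 2 * ρ - k)} :=
            Set.ext fun g => ⟨fun h => ⟨h.1, h.2.2⟩, fun h => ⟨h.1, ball_of_witness hϖ1.le hf₀ hf₀' hle h.2, h.2⟩⟩
          rw [hnest, max_eq_right hle, ncard_glue_representatives_eq hσ hvσ hfix hϖ hd (by omega) (by omega) hRfin hR1 hR2 hR3 hge hσf₀ hf₀',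
            show 2 * ρ - (ℓ + 2 * ρ - k + 1) / 2 = (ρ + 1) / 2 - (ℓ + 2 * ρ - k + 1) / 2 + (ρ + ρ / 2) by omega, pow_add]
          push_cast
          ring
        · have hle' : ℓ + 2 * ρ - k ≤ 2 * ρ - n₁ := by omega
          have hnest : {g ∈ R | Valued.v (g + (β - 1) / (α - 1)) ≤ Valued.v ϖ ^ (2 * ρ - n₁) ∧
                Valued.v (g + (e 2 - e 1) / (e 2 - e 0)) ≤ Valued.v ϖ ^ (ℓ + 2 * ρ - k)} =
              {g ∈ R | Valued.v (g + (β - 1) / (α - 1)) ≤ Valued.v ϖ ^ (2 * ρ - n₁)} :=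
            Set.ext fun g => ⟨fun h => ⟨h.1, h.2.1⟩, fun h => ⟨h.1, h.2, ball_of_witness hϖ1.le hf₀' hf₀ hle' h.2⟩⟩
          rw [hnest, max_eq_left hle', ncard_glue_representatives_eq hσ hvσ hfix hϖ hd (by omega) (by omega) hRfin hR1 hR2 hR3 hg₀ hσf₀ hf₀,
            show 2 * ρ - (2 * ρ - n₁ + 1) / 2 = (ρ + 1) / 2 - (2 * ρ - n₁ + 1) / 2 + (ρ + ρ / 2) by omega, pow_add]
          push_cast
          ring
      · rw [if_neg hrat]
        have hemp : {g ∈ R | Valued.v (g + (β - 1) / (α - 1)) ≤ Valued.v ϖ ^ (2 * ρ - n₁) ∧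
            Valued.v (g + (e 2 - e 1) / (e 2 - e 0)) ≤ Valued.v ϖ ^ (ℓ + 2 * ρ - k)} = ∅ :=
          Set.eq_empty_of_forall_notMem fun g ⟨hgR, hg₁, hg₂⟩ => hrat ⟨g, (hR1 g hgR).1, hg₁, hg₂⟩
        rw [hemp, Set.ncard_empty, Nat.cast_zero, zero_mul]
  · rw [if_neg hout, if_neg hout]

end Closed

/-! ## §3  The model token `D₁ = diag(α−1, β−1, 0)` on `H`: fully numeric -/

section Model

variable {K : Type} [Field K] [Valued K ℤᵐ⁰] [Fintype 𝓀[K]] {σ : K →+* K} {ϖ : K} {d t : ℕ} {α β : K} {N₀ n₁ n₂ n₃ : ℕ} {T : GL (Fin 3) K}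

omit [Fintype 𝓀[K]] in
/-- The valuation data of the model token `e = (α−1, β−1, 0)` on `H`'s locus `n₁ = n₂`: `v(e₂−e₀) = v(e₂−e₁) = n₂`, `v(e₁−e₀) = n₃`, and the outer token
conjuncts collapse to `ℓ + ρ ≤ n₂` as soon as `n₂ ≤ n₃`. [cite: Kottwitz1986BaseChangeUnits, §1 pp. 240–241] -/
theorem modelToken_data_H {ϖ α β : K} (hϖ : Valued.v ϖ = exp (-1 : ℤ)) {n₁ n₂ n₃ : ℕ} (h₁ : Valued.v (β - 1) = Valued.v ϖ ^ n₁)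
    (h₂ : Valued.v (α - 1) = Valued.v ϖ ^ n₂) (h₃ : Valued.v (α - β) = Valued.v ϖ ^ n₃) (h12 : n₁ = n₂) (h23 : n₂ ≤ n₃) (ℓ ρ : ℕ) :
    Valued.v ((![α - 1, β - 1, 0] : Fin 3 → K) 2 - (![α - 1, β - 1, 0] : Fin 3 → K) 0) = Valued.v ϖ ^ n₂ ∧
      Valued.v ((![α - 1, β - 1, 0] : Fin 3 → K) 2 - (![α - 1, β - 1, 0] : Fin 3 → K) 1) = Valued.v ϖ ^ n₂ ∧
      Valued.v ((![α - 1, β - 1, 0] : Fin 3 → K) 1 - (![α - 1, β - 1, 0] : Fin 3 → K) 0) = Valued.v ϖ ^ n₃ ∧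
      ((((Valued.v ((![α - 1, β - 1, 0] : Fin 3 → K) 0) ≤ Valued.v ϖ ^ ℓ ∧ Valued.v ((![α - 1, β - 1, 0] : Fin 3 → K) 1) ≤ Valued.v ϖ ^ ℓ ∧
          Valued.v ((![α - 1, β - 1, 0] : Fin 3 → K) 2) ≤ Valued.v ϖ ^ ℓ) ∧
          Valued.v ((![α - 1, β - 1, 0] : Fin 3 → K) 1 - (![α - 1, β - 1, 0] : Fin 3 → K) 0) ≤ Valued.v ϖ ^ (ℓ + ρ)) ∧ ℓ + ρ ≤ n₂) ↔ ℓ + ρ ≤ n₂) := by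
  have hp : ∀ m n : ℕ, Valued.v ϖ ^ m ≤ Valued.v ϖ ^ n ↔ n ≤ m := fun m n => UnitaryLatticeTree.v_pow_le_v_pow_iff hϖ m n
  have h₃' : Valued.v (β - 1 - (α - 1)) = Valued.v ϖ ^ n₃ := by rw [show β - 1 - (α - 1) = β - α by ring, Valuation.map_sub_swap, h₃]
  simp only [Matrix.cons_val_zero, Matrix.cons_val_one, Matrix.cons_val_two, Matrix.tail_cons, Matrix.head_cons, zero_sub, Valuation.map_neg,
    h₁, h₂, h₃', h12, map_zero, zero_le, and_true, true_and, hp]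
  exact ⟨fun h => h.2, fun h => ⟨⟨⟨by omega, by omega⟩, by omega⟩, h⟩⟩

/-- **HEAD — THE LABELLED H WEIGHT FOR THE MODEL TOKEN `D₁ = diag(α−1, β−1, 0)`, TUBE ON THE LOCUS** (`2ρ ≤ n₁ = n₂`, `ρ ≤ n₃`; level `ℓ`; `E = ℓ + 2ρ − n₂`):
`Σᶠ_{M ∈ H(2ρ,2ρ,2ρ), D₁M ⊆ ϖ^ℓM} 1∕[𝒰 : S_F(M)] = [ℓ + ρ ≤ n₂] · ( (q−2)q^{2ρ−1} if ℓ + 2ρ ≤ n₂ ; q^{2ρ−⌈E∕2⌉}·[n₃ = n₂ ∧ ℓ + 2ρ − n₂ ≤ n₃ − d + 1] otherwise )`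
(§2 tube census, `g_e = g₀`, admissibility indicator `|β−α| = |ϖ|^{n₂}`, ★ bridge `exists_fixed_near_glueUnit_iff_le`). [cite: Kottwitz1986BaseChangeUnits, §1 pp. 240–241]
[cite: Serre1979, Ch. IV §2 Prop. 6] [cite: Rogawski1990, §4.9 Prop. 4.9.1 (a) p. 55] -/
theorem finsum_stabiliserWeight_stratum_H_sep_modelToken_tube (hD : IsRamifiedQuadraticDatum σ ϖ d t) (h2 : Valued.v (2 : K) < 1)
    (hE : IsElementDatum σ ϖ N₀ α β n₁ n₂ n₃) (hN₀ : d ≤ N₀) (hT : (T : Matrix (Fin 3) (Fin 3) K) = Matrix.diagonal ![α, β, 1])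
    (ρ : ℕ) (hρ : 1 ≤ ρ) (h12 : n₁ = n₂) (htube : 2 * ρ ≤ n₂) (ℓ : ℕ) :
    ∑ᶠ M ∈ {M | M ∈ stratum σ ϖ T ![2 * ρ, 2 * ρ, 2 * ρ] ∧ LatticeInLevel ϖ ℓ (Matrix.diagonal ![α - 1, β - 1, 0]) M}, stabiliserWeight σ M =
      if ℓ + ρ ≤ n₂ then
        (if ℓ + 2 * ρ ≤ n₂ then ((Fintype.card 𝓀[K] : ℚ) - 2) * (Fintype.card 𝓀[K] : ℚ) ^ (2 * ρ - 1)
          else if n₃ = n₂ ∧ ℓ + 2 * ρ - n₂ ≤ n₃ - d + 1 then (Fintype.card 𝓀[K] : ℚ) ^ (2 * ρ - (ℓ + 2 * ρ - n₂ + 1) / 2) else 0)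
      else 0 := by
  classical
  obtain ⟨hσ, hvσ, hϖ, hfix, hd, hd1, -⟩ := id hD
  obtain ⟨hαn, hβn, -, hα1, hβ1, h₁, h₂, h₃, -, hN2, hN3⟩ := id hE
  have h23 : n₂ ≤ n₃ := by
    rcases isoceles_of_isElementDatum hD hE with ⟨-, h⟩ | ⟨h, h'⟩ | ⟨h, h'⟩ <;> omega
  obtain ⟨hk, hloc, h10, hout⟩ := modelToken_data_H hϖ h₁ h₂ h₃ h12 h23 ℓ ρ
  obtain ⟨hϖ0, hϖ1⟩ := ne_zero_and_v_lt_one_of_v_eq_exp hϖ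
  have hvϖ0 : Valued.v ϖ ≠ 0 := (Valuation.ne_zero_iff _).2 hϖ0
  have hg₀ : Valued.v ((β - 1) / (α - 1)) = 1 := v_glueUnit_eq_one hvϖ0 (h12 ▸ h₁) h₂
  have hαd : Valued.v (α - 1) ≤ Valued.v ϖ ^ d := by rw [h₂]; exact pow_le_pow_right_of_le_one' hϖ1.le (by omega)
  have hβd : Valued.v (β - 1) ≤ Valued.v ϖ ^ d := by rw [h₁]; exact pow_le_pow_right_of_le_one' hϖ1.le (by omega)
  have hple : ∀ m n : ℕ, Valued.v ϖ ^ m ≤ Valued.v ϖ ^ n ↔ n ≤ m := fun m n => UnitaryLatticeTree.v_pow_le_v_pow_iff hϖ m n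
  have hpeq : ∀ m n : ℕ, Valued.v ϖ ^ m = Valued.v ϖ ^ n ↔ m = n := fun m n =>
    ⟨fun h => le_antisymm ((hple n m).1 h.ge) ((hple m n).1 h.le), fun h => by rw [h]⟩
  rw [finsum_stabiliserWeight_stratum_H_sep_onLocus_tube hD h2 hE hT ρ hρ ⟨by omega, htube⟩ (by omega) ℓ n₂ _ hk hloc]
  simp only [hout, glueRatio_modelToken_eq]
  simp only [h10, hpeq]
  by_cases hℓ : ℓ + ρ ≤ n₂
  · rw [if_pos hℓ, if_pos hℓ]
    by_cases hvac : ℓ + 2 * ρ ≤ n₂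
    · rw [if_pos hvac, if_pos hvac]
    · rw [if_neg hvac, if_neg hvac]
      have hbridge := exists_fixed_near_glueUnit_iff_le hσ hvσ hfix hϖ hd hd1 hαn hβn hα1 hβ1 hαd hβd h₃ (by omega) (ℓ + 2 * ρ - n₂)
      rw [hg₀, one_mul] at hbridge
      refine if_congr (and_congr Iff.rfl ?_) rfl rfl
      rw [← hbridge]
      constructor
      · rintro ⟨f, hσf, hf⟩
        exact ⟨-f, by rw [map_neg, hσf], by rw [sub_neg_eq_add, add_comm]; exact hf⟩
      · rintro ⟨f, hσf, hf⟩
        exact ⟨-f, by rw [map_neg, hσf], by rw [show -f + (β - 1) / (α - 1) = (β - 1) / (α - 1) - f by ring]; exact hf⟩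
  · rw [if_neg hℓ, if_neg hℓ]

/-- **HEAD — THE LABELLED H WEIGHT FOR THE MODEL TOKEN `D₁ = diag(α−1, β−1, 0)` ON THE EQUILATERAL FOOT** (`n₁ = n₂ = n₃ = m`, `ρ ≤ m < 2ρ`; level `ℓ`;
`E = ℓ + 2ρ − m`; the balls are concentric, the token ball the finer): `Σᶠ_{M ∈ H(2ρ,2ρ,2ρ), D₁M ⊆ ϖ^ℓM} 1∕[𝒰 : S_F(M)] =`
`[ℓ + ρ ≤ m ∧ ℓ + 2ρ − m ≤ m − d + 1] · q^{2ρ−⌈E∕2⌉}` (§2 foot census + ★ bridge). [cite: Kottwitz1986BaseChangeUnits, §1 pp. 240–241]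
[cite: Serre1979, Ch. IV §2 Prop. 6] [cite: Rogawski1990, §4.9 Prop. 4.9.1 (a) p. 55] -/
theorem finsum_stabiliserWeight_stratum_H_sep_modelToken_foot (hD : IsRamifiedQuadraticDatum σ ϖ d t) (h2 : Valued.v (2 : K) < 1)
    (hE : IsElementDatum σ ϖ N₀ α β n₁ n₂ n₃) (hN₀ : d ≤ N₀) (hT : (T : Matrix (Fin 3) (Fin 3) K) = Matrix.diagonal ![α, β, 1])
    (ρ : ℕ) (hρ : 1 ≤ ρ) (h12 : n₁ = n₂) (h13 : n₁ = n₃) (hρm : ρ ≤ n₁) (hm : n₁ < 2 * ρ) (ℓ : ℕ) :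
    ∑ᶠ M ∈ {M | M ∈ stratum σ ϖ T ![2 * ρ, 2 * ρ, 2 * ρ] ∧ LatticeInLevel ϖ ℓ (Matrix.diagonal ![α - 1, β - 1, 0]) M}, stabiliserWeight σ M =
      if ℓ + ρ ≤ n₁ ∧ ℓ + 2 * ρ - n₁ ≤ n₁ - d + 1 then (Fintype.card 𝓀[K] : ℚ) ^ (2 * ρ - (ℓ + 2 * ρ - n₁ + 1) / 2) else 0 := by
  classical
  obtain ⟨hσ, hvσ, hϖ, hfix, hd, hd1, -⟩ := id hD
  obtain ⟨hαn, hβn, -, hα1, hβ1, h₁, h₂, h₃, -, hN2, hN3⟩ := id hE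
  obtain ⟨hk, hloc, -, hout⟩ := modelToken_data_H hϖ h₁ h₂ h₃ h12 (by omega) ℓ ρ
  obtain ⟨hϖ0, hϖ1⟩ := ne_zero_and_v_lt_one_of_v_eq_exp hϖ
  have hvϖ0 : Valued.v ϖ ≠ 0 := (Valuation.ne_zero_iff _).2 hϖ0
  have hg₀ : Valued.v ((β - 1) / (α - 1)) = 1 := v_glueUnit_eq_one hvϖ0 (h12 ▸ h₁) h₂
  have hαd : Valued.v (α - 1) ≤ Valued.v ϖ ^ d := by rw [h₂]; exact pow_le_pow_right_of_le_one' hϖ1.le (by omega)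
  have hβd : Valued.v (β - 1) ≤ Valued.v ϖ ^ d := by rw [h₁]; exact pow_le_pow_right_of_le_one' hϖ1.le (by omega)
  rw [finsum_stabiliserWeight_stratum_H_sep_onLocus_foot hD h2 hE hT ρ hρ h12 h13 hρm hm ℓ n₂ _ hk hloc]
  simp only [hout, glueRatio_modelToken_eq]
  have hbridge := exists_fixed_near_glueUnit_iff_le hσ hvσ hfix hϖ hd hd1 hαn hβn hα1 hβ1 hαd hβd h₃ (by omega) (ℓ + 2 * ρ - n₂)
  rw [hg₀, one_mul] at hbridge
  have hbridge' : (∃ f : K, σ f = f ∧ Valued.v (f + (β - 1) / (α - 1)) ≤ Valued.v ϖ ^ (ℓ + 2 * ρ - n₂)) ↔ ℓ + 2 * ρ - n₂ ≤ n₃ - d + 1 := by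
    rw [← hbridge]
    constructor
    · rintro ⟨f, hσf, hf⟩
      exact ⟨-f, by rw [map_neg, hσf], by rw [show (β - 1) / (α - 1) - -f = f + (β - 1) / (α - 1) by ring]; exact hf⟩
    · rintro ⟨f, hσf, hf⟩
      exact ⟨-f, by rw [map_neg, hσf], by rw [show -f + (β - 1) / (α - 1) = (β - 1) / (α - 1) - f by ring]; exact hf⟩
  by_cases hℓ : ℓ + ρ ≤ n₂
  · rw [if_pos hℓ, if_neg (by omega : ¬ ℓ + 2 * ρ ≤ n₂), max_eq_right (by omega : 2 * ρ - n₁ ≤ ℓ + 2 * ρ - n₂)]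
    refine if_congr ⟨fun ⟨f, hσf, _, hf⟩ => ⟨by omega, by have := hbridge'.1 ⟨f, hσf, hf⟩; omega⟩, fun h => ?_⟩ (by rw [h12]) rfl
    obtain ⟨f₀, hσf₀, hf₀⟩ := hbridge'.2 (by omega)
    exact ⟨f₀, hσf₀, hf₀.trans (pow_le_pow_right_of_le_one' hϖ1.le (by omega)), hf₀⟩
  · rw [if_neg hℓ, if_neg (fun h => hℓ (h12 ▸ h.1))]

end Model

end Summit.HodgeConjecture.HodgeConjecture.Cruxes.H413.F0P3cDyRamLabelledCoreHangingLocusCensusClosed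

end
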